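import Summits.MatrixMultiplication.OmegaCensus.STPPTricoloredProduct

/-!
# ω-census, tricolored-sum-free TOOLKIT for the `N₅` assembly: products of TSF sets and the exact small-group instances

HONEST FRAMING (pub-omega census; verbatim): lottery ticket; floor = certified bounds/negative ranges.
Census STRUCTURE bookkeeping (question Q7: the uniform threshold `N₅`), not progress on `ω`.  Every item here is a TOOL for the
product law NR142 (`exists_isSTPP_222pow_mul_of_tsf`: `(2,2,2)^N ⊆ H₁` and a tricolored-sum-free set of size `k` in `H₂` give
`(2,2,2)^{N·k} ⊆ H₁ × H₂`), as consumed by the seat's seed-demand planner (HOME `pub-omega-stpp-3-g10/N5-ASSEMBLY-PLAN.md`,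
`code/n5/n5bound2.py`): with the uniform laws `N₁ = 10`, Pb47, `N₃ = 46`, `N₄ ≤ 66`, the 40 kernel `k = 5` seeds and the TSF supplies
below, every finite abelian group of order `≥ 136` is coverable by kernel routes to `(2,2,2)⁵`.

* `IsTricoloredSumFree.prodMk` — **products of tricolored sum-free sets are tricolored sum-free** (coordinatewise, index set
  `ι × ι'`); `exists_isTSF_mul` — the `Fin (a·b)` packaging.
* `exists_isTSF_two_of_ne` — `{0, g}` three times with third colour `{0, −2g}` is a TSF of size 2 whenever `g ≠ 0` and `g + g ≠ 0`
  (any element of order `≥ 3`); `exists_isTSF_two_zmod (q ≥ 3)`, `exists_isTSF_two_zmod2_sq`.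
* EXACT SMALL INSTANCES (maximum sizes, by the seat's exhaustive `tsfmaxg.py`; each a `decide`): size 5 in `ℤ/14`, `ℤ/15`, `ℤ/16`
  (`ℤ/13` is in `STPPTricoloredProduct`); size 6 in `ℤ/4 × ℤ/4`, `ℤ/2 × ℤ/8`, `ℤ/2 × ℤ/2 × ℤ/4`, `(ℤ/2)⁴`; size 4 in `ℤ/9 … ℤ/12`
  (the 3-AP-free set `{0,1,3,4}`).  Measured maxima (not kernel statements): `ℤ/4,5 → 2`, `ℤ/7,8 → 3`, `ℤ/9…12 → 4`, `ℤ/13…16 → 5`,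
  non-cyclic order 16 → 6, `ℤ/3 × ℤ/3 → 4`.

References: J. Blasiak et al., Discrete Analysis 2017:3, Def. 3.1; H. Cohn, R. Kleinberg, B. Szegedy, C. Umans, FOCS 2005, Def. 5.1.
Seat pub-omega-stpp-3 (gen 10), 2026-08-24.
-/

open Literature.Computability.AlgebraicComplexity Literature.Combinatorics.Additive Finset

namespace Summit.MatrixMultiplication.OmegaCensus

/-! ## Products -/

/-- **Products of tricolored sum-free sets** (componentwise, indexed by `ι × ι'`).
[cite: BlasiakChurchCohnGrochowNaslundSawinUmans2017, Def. 3.1] -/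
theorem _root_.Literature.Combinatorics.Additive.IsTricoloredSumFree.prodMk {ι ι' H H' : Type*} [AddCommGroup H]
    [AddCommGroup H'] {s t u : ι → H} {s' t' u' : ι' → H'} (h : IsTricoloredSumFree s t u)
    (h' : IsTricoloredSumFree s' t' u') :
    IsTricoloredSumFree (fun p : ι × ι' => ((s p.1, s' p.2) : H × H')) (fun p => (t p.1, t' p.2))
      (fun p => (u p.1, u' p.2)) := by
  intro i j l
  rw [Prod.mk_add_mk, Prod.mk_add_mk, Prod.mk_eq_zero, h i.1 j.1 l.1, h' i.2 j.2 l.2, Prod.ext_iff, Prod.ext_iff]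
  tauto

/-- **TSF sizes multiply**: a TSF of size `a` in `H` and one of size `b` in `H'` give one of size `a·b` in `H × H'`.
[cite: BlasiakChurchCohnGrochowNaslundSawinUmans2017, Def. 3.1] -/
theorem exists_isTSF_mul {H H' : Type*} [AddCommGroup H] [AddCommGroup H'] {a b : ℕ}
    (h : ∃ s t u : Fin a → H, IsTricoloredSumFree s t u) (h' : ∃ s t u : Fin b → H', IsTricoloredSumFree s t u) :
    ∃ s t u : Fin (a * b) → H × H', IsTricoloredSumFree s t u := by
  obtain ⟨s, t, u, hT⟩ := h
  obtain ⟨s', t', u', hT'⟩ := h'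
  have hp := (hT.prodMk hT').comp (e := finProdFinEquiv.symm) finProdFinEquiv.symm.injective
  exact ⟨_, _, _, hp⟩

/-! ## Size 2 from one element of order `≥ 3` -/

/-- **A tricolored sum-free pair from an element of order `≥ 3`**: `s = t = (0, g)`, `u = (0, −(g+g))` with `g ≠ 0`, `g + g ≠ 0`.
[cite: BlasiakChurchCohnGrochowNaslundSawinUmans2017, Def. 3.1] -/
theorem exists_isTSF_two_of_ne {H : Type*} [AddCommGroup H] (g : H) (hg : g ≠ 0) (h2 : g + g ≠ 0) :
    ∃ s t u : Fin 2 → H, IsTricoloredSumFree s t u := by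
  refine ⟨![0, g], ![0, g], ![0, -(g + g)], ?_⟩
  have hng : -g ≠ 0 := neg_ne_zero.2 hg
  have h3 : -g + -g ≠ 0 := by rw [← neg_add, neg_ne_zero]; exact h2
  intro i j l
  fin_cases i <;> fin_cases j <;> fin_cases l <;> simp [hg, h2, h3, hng]

/-- `ℤ/q`, `q ≥ 3`, carries a tricolored sum-free set of size 2 (`g = 1`). [cite: BlasiakChurchCohnGrochowNaslundSawinUmans2017, Def. 3.1] -/
theorem exists_isTSF_two_zmod (q : ℕ) (hq : 3 ≤ q) : ∃ s t u : Fin 2 → ZMod q, IsTricoloredSumFree s t u := by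
  refine exists_isTSF_two_of_ne (1 : ZMod q) ?_ ?_
  · haveI : Fact (1 < q) := ⟨by omega⟩
    exact one_ne_zero
  · have h : ((2 : ℕ) : ZMod q) ≠ 0 := by
      rw [Ne, ZMod.natCast_eq_zero_iff]
      exact fun hd => by have := Nat.le_of_dvd (by norm_num) hd; omega
    rw [show (1 : ZMod q) + 1 = ((2 : ℕ) : ZMod q) by push_cast; norm_num]
    exact h

/-- `ℤ/2 × ℤ/2` carries a tricolored sum-free set of size 2 (the graph on two points). -/
theorem exists_isTSF_two_zmod2_sq : ∃ s t u : Fin 2 → ZMod 2 × ZMod 2, IsTricoloredSumFree s t u :=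
  ⟨![(0,0), (1,0)], ![(0,0), (0,1)], ![(0,0), (1,1)], by unfold IsTricoloredSumFree; decide⟩

/-! ## Exact small instances (exhaustive search `tsfmaxg.py`; kernel `decide`) -/

/-- `ℤ/16` carries a tricolored sum-free set of size 5 (maximum). [cite: BlasiakChurchCohnGrochowNaslundSawinUmans2017, Def. 3.1] -/
theorem exists_isTSF_five_zmod16 : ∃ s t u : Fin 5 → ZMod 16, IsTricoloredSumFree s t u :=
  ⟨![0, 1, 3, 4, 7], ![0, 1, 3, 8, 7], ![0, 14, 10, 4, 2], by unfold IsTricoloredSumFree; decide⟩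

/-- `ℤ/15` carries a tricolored sum-free set of size 5 (maximum). -/
theorem exists_isTSF_five_zmod15 : ∃ s t u : Fin 5 → ZMod 15, IsTricoloredSumFree s t u :=
  ⟨![0, 1, 3, 4, 9], ![0, 1, 3, 7, 4], ![0, 13, 9, 4, 2], by unfold IsTricoloredSumFree; decide⟩

/-- `ℤ/14` carries a tricolored sum-free set of size 5 (maximum). -/
theorem exists_isTSF_five_zmod14 : ∃ s t u : Fin 5 → ZMod 14, IsTricoloredSumFree s t u :=
  ⟨![0, 1, 3, 9, 12], ![0, 1, 3, 10, 9], ![0, 12, 8, 9, 7], by unfold IsTricoloredSumFree; decide⟩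

/-- `ℤ/4 × ℤ/4` carries a tricolored sum-free set of size 6 (maximum). -/
theorem exists_isTSF_six_zmod4_sq : ∃ s t u : Fin 6 → ZMod 4 × ZMod 4, IsTricoloredSumFree s t u :=
  ⟨![(0,0), (0,1), (1,0), (1,1), (1,3), (3,1)], ![(0,0), (0,1), (1,0), (2,2), (2,1), (1,2)],
    ![(0,0), (0,2), (2,0), (1,1), (1,0), (0,1)], by unfold IsTricoloredSumFree; decide⟩

/-- `ℤ/2 × ℤ/8` carries a tricolored sum-free set of size 6 (maximum). -/
theorem exists_isTSF_six_zmod2_zmod8 : ∃ s t u : Fin 6 → ZMod 2 × ZMod 8, IsTricoloredSumFree s t u :=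
  ⟨![(0,0), (0,1), (0,4), (1,2), (1,3), (1,4)], ![(0,0), (0,1), (1,2), (1,1), (0,5), (1,3)],
    ![(0,0), (0,6), (1,2), (0,5), (1,0), (0,1)], by unfold IsTricoloredSumFree; decide⟩

/-- `ℤ/2 × ℤ/2 × ℤ/4` carries a tricolored sum-free set of size 6 (maximum). -/
theorem exists_isTSF_six_zmod2_zmod2_zmod4 : ∃ s t u : Fin 6 → ZMod 2 × ZMod 2 × ZMod 4, IsTricoloredSumFree s t u :=
  ⟨![(0,0,0), (0,0,1), (0,0,2), (0,1,2), (1,0,1), (1,1,0)], ![(0,0,0), (0,1,0), (1,0,0), (1,1,1), (1,1,2), (1,1,3)],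
    ![(0,0,0), (0,1,3), (1,0,2), (1,0,1), (0,1,1), (0,0,1)], by unfold IsTricoloredSumFree; decide⟩

/-- `(ℤ/2)⁴` carries a tricolored sum-free set of size 6 (maximum). -/
theorem exists_isTSF_six_zmod2_pow4 : ∃ s t u : Fin 6 → ZMod 2 × ZMod 2 × ZMod 2 × ZMod 2, IsTricoloredSumFree s t u :=
  ⟨![(0,0,0,0), (0,0,0,1), (0,1,0,0), (0,1,1,0), (1,0,0,1), (1,0,1,0)],
    ![(0,0,0,0), (0,0,1,0), (1,0,0,0), (1,0,1,1), (1,1,1,0), (1,1,1,1)],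
    ![(0,0,0,0), (0,0,1,1), (1,1,0,0), (1,1,0,1), (0,1,1,1), (0,1,0,1)], by unfold IsTricoloredSumFree; decide⟩

/-- `ℤ/9` carries a tricolored sum-free set of size 4 (the 3-AP-free set `{0,1,3,4}`; maximum). -/
theorem exists_isTSF_four_zmod9 : ∃ s t u : Fin 4 → ZMod 9, IsTricoloredSumFree s t u :=
  ⟨![0, 1, 3, 4], ![0, 1, 3, 4], ![0, 7, 3, 1], by unfold IsTricoloredSumFree; decide⟩

/-- `ℤ/10` carries a tricolored sum-free set of size 4 (maximum). -/
theorem exists_isTSF_four_zmod10 : ∃ s t u : Fin 4 → ZMod 10, IsTricoloredSumFree s t u :=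
  ⟨![0, 1, 3, 4], ![0, 1, 3, 4], ![0, 8, 4, 2], by unfold IsTricoloredSumFree; decide⟩

/-- `ℤ/11` carries a tricolored sum-free set of size 4 (maximum). -/
theorem exists_isTSF_four_zmod11 : ∃ s t u : Fin 4 → ZMod 11, IsTricoloredSumFree s t u :=
  ⟨![0, 1, 3, 4], ![0, 1, 3, 4], ![0, 9, 5, 3], by unfold IsTricoloredSumFree; decide⟩

/-- `ℤ/12` carries a tricolored sum-free set of size 4 (maximum). -/
theorem exists_isTSF_four_zmod12 : ∃ s t u : Fin 4 → ZMod 12, IsTricoloredSumFree s t u :=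
  ⟨![0, 1, 3, 4], ![0, 1, 3, 4], ![0, 10, 6, 4], by unfold IsTricoloredSumFree; decide⟩

/-! ## Two consumers (instances of NR142 with the new supplies) -/

/-- **`(2,2,2)⁵ ⊆ K × ℤ/16` for every abelian `K` carrying one `(2,2,2)` triple** (e.g. `|K| ≥ 10`): NR142 with the size-5 TSF of `ℤ/16`
— covers the `N₅` planner's residual type `ℤ/16 × ℤ/16`. [cite: CohnKleinbergSzegedyUmans2005, Def. 5.1] -/
theorem exists_isSTPP_222pow5_prod_zmod16 {K : Type*} [AddCommGroup K]
    (hK : ∃ A B C : Fin 1 → Finset K, IsSTPP A B C ∧ ∀ i, (A i).card = 2 ∧ (B i).card = 2 ∧ (C i).card = 2) :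
    ∃ A B C : Fin 5 → Finset (K × ZMod 16), IsSTPP A B C ∧ ∀ i, (A i).card = 2 ∧ (B i).card = 2 ∧ (C i).card = 2 := by
  obtain ⟨s, t, u, hT⟩ := exists_isTSF_five_zmod16
  have h := exists_isSTPP_222pow_mul_of_tsf hK hT
  rwa [one_mul] at h

/-- **`(2,2,2)⁶ ⊆ K × L` whenever `K` carries `(2,2,2)³` and `L` is one of the order-16 groups above**, e.g. `(ℤ/2)⁴`: NR142 with a
size-6 TSF — so `(ℤ/2)^{10} = (ℤ/2)⁶ × (ℤ/2)⁴` hosts `(2,2,2)⁶` as soon as `(ℤ/2)⁶` hosts `(2,2,2)³` (it does: `N₃ = 46`).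
[cite: CohnKleinbergSzegedyUmans2005, Def. 5.1] -/
theorem exists_isSTPP_222pow6_prod_zmod2_pow4 {K : Type*} [AddCommGroup K]
    (hK : ∃ A B C : Fin 3 → Finset K, IsSTPP A B C ∧ ∀ i, (A i).card = 2 ∧ (B i).card = 2 ∧ (C i).card = 2) :
    ∃ A B C : Fin 18 → Finset (K × (ZMod 2 × ZMod 2 × ZMod 2 × ZMod 2)), IsSTPP A B C ∧
      ∀ i, (A i).card = 2 ∧ (B i).card = 2 ∧ (C i).card = 2 := by
  obtain ⟨s, t, u, hT⟩ := exists_isTSF_six_zmod2_pow4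
  exact exists_isSTPP_222pow_mul_of_tsf hK hT

end Summit.MatrixMultiplication.OmegaCensus
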